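import Literature.Topology.FourManifolds.AchiralLefschetzNullTower
import Literature.Topology.FourManifolds.SPC4HandlesTwoHandlebodyGenusCount
import Literature.Topology.FourManifolds.DoubleThickeningProofs
import Literature.Topology.FourManifolds.HandleAttachingMapsUniqueness
import HarnessLib

/-!
# The closed model of the empty word bounds a compact 5-dimensional `1`-handlebody
# (third input of the null tower, modulo Laudenbach–Poénaru)

Topic `Literature/Topology/FourManifolds`; proof file (no definitions, no named facts) next to
`AchiralLefschetzNullTower.lean`, reducing its third named fact
`exists_isHandlebodyOfIndexLE_one_of_isAchiralLefschetzModel_nil` — *the closed achiral Lefschetz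
model `X̂(P; [])` of the EMPTY word over any page bounds a compact 5-dimensional `1`-handlebody* —
to the Laudenbach–Poénaru extension theorem `exists_diffeomorph_comp_incl_eq` (`SPC4Handles.lean`,
named fact: every self-diffeomorphism of the boundary of a compact connected orientable
4-dimensional `1`-handlebody extends), at every universe
(`exists_isHandlebodyOfIndexLE_one_of_isAchiralLefschetzModel_nil_holds_of_LP`; the line
`hurwitz-deletion-presentation` of the crux `ConvexBisection.AcyclicBisectionRigidity`, item
stmt-SmoothPoincare4-10507, consumes the instance `…_holds0_of_LP` at universe `0`).  The
reduction cannot be improved to an unconditional discharge by cheaper means: for the fake base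
`B = V = 𝔻⁴` the fact says that every twisted 4-sphere `𝔻⁴ ∪_h 𝔻⁴` bounds a compact
5-dimensional `1`-handlebody with simply connected boundary, i.e. `B⁵` — Cerf's `Γ₄ = 0`, which the
extension theorem contains (`SPC4HandlesImpliesCerf.lean`).

**The printed proof** (Gompf–Stipsicz 1999, §4.4 and §8.2; Kirby 1989, Ch. I §2, p. 8;
Matsumoto 2001, Lemma 5.20; Laudenbach–Poénaru 1972) and where each step lives:

* §1 `IsAchiralLefschetzModel.exists_isBoundaryGluing_oneHandlebody_of_nil` — **the model of
  `[]` is a gluing of two compact connected orientable 4-dimensional `1`-handlebodies** (no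
  extension theorem needed): `M = W ∪_Ψ V` with `W` the multi-attachment of the EMPTY Lefschetz
  link to the base `B`, so `W ≅ B` (`HandleAttachingMap.IsMultiAttachment.nonempty_diffeomorph_of_isEmpty`,
  uniqueness of multi-attachments against the model `B` itself), and the gluing is transported
  along `B ≅ W` (`IsBoundaryGluing.transfer`, `CorkDecomposition.lean`): `M = B ∪_{Ψ ∘ ∂e⁻¹} V`.
* §2 `exists_isHandlebodyOfIndexLE_one_of_isBoundaryGluing_oneHandlebody_of_LP` — **a closed
  4-manifold glued from two compact connected orientable `1`-handlebodies bounds a compact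
  5-dimensional `1`-handlebody**, granted the extension theorem: `∂V ≅ ∂B` forces `V ≅ B`
  (Kosinski VI (11.4)(c) with the genus count, tree theorem
  `nonempty_diffeomorph_of_isHandlebodyOfIndexLE_one_of_boundary_homeomorph`,
  `SPC4HandlesTwoHandlebodyGenusCount.lean`); "it makes no difference how the 3- and 4-handles are
  attached" (Kirby p. 8; tree theorem
  `nonempty_diffeomorph_of_isBoundaryGluing_of_laudenbachPoenaru_of_diffeomorph`,
  `SPC4HandlesTwoHandlebodyProofs.lean`), so `M ≅ B ∪_{id} B = D(B)`, the double, which exists by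
  `exists_isBoundaryGluing_holds` (`GluingProofs.lean`); and the double of a compact `k`-handlebody
  bounds its thickening `B × [0, 1]`, a compact `k`-handlebody one dimension up with a boundary
  embedding (Freedman–Gompf–Morrison–Walker 2010, proof of Fact 2; tree theorem
  `DoubleThickening.exists_counted_thickening`, `DoubleThickeningProofs.lean`).  On paper:
  `M ≅ D(♮ᵐ S¹ × B³) = #ᵐ S¹ × S³ = ∂(♮ᵐ S¹ × B⁴)`.
* §3 the fact, conditionally: `…_holds_of_LP` (every universe) and `…_holds0_of_LP` (universe `0`).
  The unconditional discharge `…_holds` is `…_holds_of_LP exists_diffeomorph_comp_incl_eq_holds`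
  once the extension theorem lands (fact seat
  `provefact-Literature.Topology.FourManifolds.exists_diffeomorph_comp_incl_eq`).

## References

* F. Laudenbach, V. Poénaru, *A note on 4-dimensional handlebodies*, Bull. Soc. Math. France 100
  (1972), 337–344, main theorem. [LaudenbachPoenaruBSMF1972]
* R. E. Gompf, A. I. Stipsicz, *4-Manifolds and Kirby Calculus*, GSM 20 (1999), §4.4, §8.2.
  [GompfStipsiczGSM1999]
* R. C. Kirby, *The topology of 4-manifolds*, LNM 1374 (1989), Ch. I §2, p. 8 and p. 18.
  [Kirby1989]
* Y. Matsumoto, *An Introduction to Morse Theory*, Transl. Math. Monogr. 208 (2001), §5.3,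
  Lemma 5.20. [Matsumoto2001]
* A. A. Kosinski, *Differential Manifolds* (1993), VI (11.4)(c), VI §5 (the double). [Kosinski1993]
* M. Freedman, R. Gompf, S. Morrison, K. Walker, *Man and machine thinking about the smooth
  4-dimensional Poincaré conjecture*, Quantum Topol. 1 (2010), proof of Fact 2.
  [FreedmanGompfMorrisonWalker2010]
-/

open scoped Manifold ContDiff Topology ContinuousMap
open Set Function

noncomputable section

namespace Literature.Topology.FourManifolds

universe u v

/-! ### §1 The model of the empty word is a gluing of two `1`-handlebodies -/

section Nil

variable {P : Type v} [TopologicalSpace P] [T2Space P] [SecondCountableTopology P] [CompactSpace P]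
  [ConnectedSpace P] [ChartedSpace (EuclideanHalfSpace 2) P] [IsManifold (𝓡∂ 2) ∞ P]
  {o : SmoothOrientation (𝓡∂ 2) P}

omit [T2Space P] [SecondCountableTopology P] [CompactSpace P] [ConnectedSpace P] in
/-- **The closed model of the empty word is a closed 4-manifold glued from two compact connected
orientable 4-dimensional `1`-handlebodies along a boundary diffeomorphism.**  If
`M = X̂(P; []) = W ∪_Ψ V` (`IsAchiralLefschetzModel P o [] M`), the achiral Lefschetz handlebody
`W = X(P; [])` is the base `1`-handlebody `B` with NO 2-handle attached: a multi-attachment along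
the empty family of attaching maps, hence `W ≅ B`
(`HandleAttachingMap.IsMultiAttachment.nonempty_diffeomorph_of_isEmpty`); transporting the gluing
along `e⁻¹ : B ≅ W` (`IsBoundaryGluing.transfer`) exhibits `M = B ∪_{Ψ ∘ ∂e⁻¹} V` with both
pieces compact connected orientable `1`-handlebodies (Gompf–Stipsicz 1999, §8.2: `X(P; []) = P × D²
≅ ♮ᵏ S¹ × B³`; only the `1`-handlebody clauses of `IsLefschetzHandlebodyOver` are used, so the
statement holds for every base the predicate admits). [cite: GompfStipsiczGSM1999, §8.2] -/
theorem IsAchiralLefschetzModel.exists_isBoundaryGluing_oneHandlebody_of_nil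
    {M : Type u} [TopologicalSpace M] [ChartedSpace (EuclideanSpace ℝ (Fin 4)) M]
    (hM : IsAchiralLefschetzModel P o ([] : List (SignedCycle P)) M) :
    ∃ (B : Type u) (_ : TopologicalSpace B) (_ : T2Space B) (_ : SecondCountableTopology B)
      (_ : CompactSpace B) (_ : ConnectedSpace B) (_ : ChartedSpace (EuclideanHalfSpace 4) B)
      (_ : IsManifold (𝓡∂ 4) ∞ B)
      (V : Type u) (_ : TopologicalSpace V) (_ : T2Space V) (_ : SecondCountableTopology V)
      (_ : CompactSpace V) (_ : ConnectedSpace V) (_ : ChartedSpace (EuclideanHalfSpace 4) V)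
      (_ : IsManifold (𝓡∂ 4) ∞ V)
      (b : BoundaryData (𝓡∂ 4) B (𝓡 3)) (bV : BoundaryData (𝓡∂ 4) V (𝓡 3))
      (ψ : b.carrier ≃ₘ⟮𝓡 3, 𝓡 3⟯ bV.carrier),
      IsHandlebodyOfIndexLE 3 1 B ∧ IsOrientable (𝓡∂ 4) B ∧
        IsHandlebodyOfIndexLE 3 1 V ∧ IsOrientable (𝓡∂ 4) V ∧ IsBoundaryGluing b bV ψ (𝓡 4) M := by
  obtain ⟨W, _, _, _, _, _, _, V, _, _, _, _, _, _, _, bW, bV, Ψ, hW, hV, hVo, hglue⟩ := hM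
  obtain ⟨B, _, _, _, _, _, _, _, b, ob, J, δ, h, hB, hBo, -, hmult⟩ := hW
  -- no 2-handles: `W ≅ B` by uniqueness of multi-attachments against the model `B`
  haveI : IsEmpty (Fin ([] : List (SignedCycle P)).length) := Fin.isEmpty'
  obtain ⟨e⟩ := hmult.nonempty_diffeomorph_of_isEmpty
  -- transport the gluing `M = W ∪_Ψ V` along `e⁻¹ : B ≅ W`: `M = B ∪_{Ψ ∘ ∂e⁻¹} V`
  refine ⟨B, ‹_›, ‹_›, ‹_›, ‹_›, ‹_›, ‹_›, ‹_›, V, ‹_›, ‹_›, ‹_›, ‹_›, ‹_›, ‹_›, ‹_›, b, bV,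
    (b.restrictDiffeomorph bW e.symm).trans Ψ, hB, hBo, hV, hVo, ?_⟩
  rw [Diffeomorph.coe_trans]
  exact hglue.transfer e.symm

end Nil

/-! ### §2 A gluing of two `1`-handlebodies bounds a 5-dimensional `1`-handlebody (modulo LP) -/

/-- **A closed 4-manifold glued from two compact connected orientable 4-dimensional
`1`-handlebodies bounds a compact 5-dimensional `1`-handlebody**, granted the Laudenbach–Poénaru
extension theorem `exists_diffeomorph_comp_incl_eq`.  Let `M = B ∪_ψ V` (`IsBoundaryGluing`) with
`B`, `V` compact connected orientable and `IsHandlebodyOfIndexLE 3 1`.  Then `∂V ≅ ∂B` (by `ψ⁻¹`)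
forces `V ≅ B` (Kosinski 1993, VI (11.4)(c) with the genus count `π₁(#ᵏ S¹ × S²) ≅ F_k`; tree
`nonempty_diffeomorph_of_isHandlebodyOfIndexLE_one_of_boundary_homeomorph`); by the extension
theorem "it makes no difference how the 3- and 4-handles are attached" (Kirby 1989, Ch. I §2,
p. 8; Matsumoto 2001, proof of Lemma 5.20; tree
`nonempty_diffeomorph_of_isBoundaryGluing_of_laudenbachPoenaru_of_diffeomorph`), so
`M ≅ B ∪_{id} B = D(B)`, the double of `B` (which exists, `exists_isBoundaryGluing_holds`); and the
double of a compact `1`-handlebody bounds its thickening `B × [0, 1]` (corners straightened), a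
compact `1`-handlebody one dimension up, by a boundary embedding (Freedman–Gompf–Morrison–Walker
2010, proof of Fact 2; Kirby 1989, p. 18; tree `DoubleThickening.exists_counted_thickening`),
which is precomposed with `M ≅ D(B)`.  On paper: `M ≅ D(♮ᵐ S¹ × B³) = #ᵐ S¹ × S³ = ∂(♮ᵐ S¹ × B⁴)`.
[cite: LaudenbachPoenaruBSMF1972, main theorem] [cite: Kirby1989, Ch. I §2, p. 8 and p. 18]
[cite: Kosinski1993, VI (11.4)(c)] -/
theorem exists_isHandlebodyOfIndexLE_one_of_isBoundaryGluing_oneHandlebody_of_LP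
    (hLP : exists_diffeomorph_comp_incl_eq.{u})
    {M : Type u} [TopologicalSpace M] [ChartedSpace (EuclideanSpace ℝ (Fin 4)) M] [IsManifold (𝓡 4) ∞ M]
    (B : Type u) [TopologicalSpace B] [T2Space B] [SecondCountableTopology B] [CompactSpace B]
    [ConnectedSpace B] [ChartedSpace (EuclideanHalfSpace 4) B] [IsManifold (𝓡∂ 4) ∞ B]
    (V : Type u) [TopologicalSpace V] [T2Space V] [SecondCountableTopology V] [CompactSpace V]
    [ConnectedSpace V] [ChartedSpace (EuclideanHalfSpace 4) V] [IsManifold (𝓡∂ 4) ∞ V]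
    (hB : IsHandlebodyOfIndexLE 3 1 B) (hBo : IsOrientable (𝓡∂ 4) B)
    (hV : IsHandlebodyOfIndexLE 3 1 V) (hVo : IsOrientable (𝓡∂ 4) V)
    (b : BoundaryData (𝓡∂ 4) B (𝓡 3)) (bV : BoundaryData (𝓡∂ 4) V (𝓡 3))
    (ψ : b.carrier ≃ₘ⟮𝓡 3, 𝓡 3⟯ bV.carrier) (hglue : IsBoundaryGluing b bV ψ (𝓡 4) M) :
    ∃ (H : Type u) (_ : TopologicalSpace H) (_ : T2Space H) (_ : SecondCountableTopology H)
      (_ : ChartedSpace (EuclideanHalfSpace (4 + 1)) H) (_ : IsManifold (𝓡∂ (4 + 1)) ∞ H)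
      (_ : CompactSpace H),
      IsHandlebodyOfIndexLE 4 1 H ∧
        ∃ φ : M → H, Manifold.IsSmoothEmbedding (𝓡 4) (𝓡∂ (4 + 1)) ∞ φ ∧
          Set.range φ = (𝓡∂ (4 + 1)).boundary H := by
  -- `V ≅ B`: compact connected orientable 4-dimensional `1`-handlebodies with homeomorphic
  -- boundaries are diffeomorphic (Kosinski VI (11.4)(c) and the genus count)
  obtain ⟨Θ⟩ := nonempty_diffeomorph_of_isHandlebodyOfIndexLE_one_of_boundary_homeomorph V B hV hB
    hVo hBo bV b ψ.symm.toHomeomorph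
  -- the double `D = B ∪_{id} B` exists
  obtain ⟨D, _, _, _, _, _, _, hD⟩ :=
    exists_isBoundaryGluing_holds b b (Diffeomorph.refl (𝓡 3) b.carrier ∞)
  -- Laudenbach–Poénaru: `M = B ∪_ψ V ≅ B ∪_{id} B = D`
  obtain ⟨Φ⟩ :=
    nonempty_diffeomorph_of_isBoundaryGluing_of_laudenbachPoenaru_of_diffeomorph hLP hV hVo Θ hglue hD
  -- the double of the `1`-handlebody `B` bounds its thickening, a 5-dimensional `1`-handlebody
  obtain ⟨f, hf, hf1⟩ := hB
  obtain ⟨H, i₁, i₂, i₃, i₄, i₅, i₆, -, -, hH, φ, hφ, hφr⟩ :=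
    DoubleThickening.exists_counted_thickening hf b D hD
  have hs : Surjective (⇑Φ) := Φ.surjective
  exact ⟨H, i₁, i₂, i₃, i₄, i₅, i₆, hH 1 hf1, φ ∘ Φ, hφ.comp_diffeomorph Φ,
    by rw [hs.range_comp, hφr]⟩

/-! ### §3 The third input of the null tower, modulo Laudenbach–Poénaru -/

/-- **Fact (3) of the null tower from the Laudenbach–Poénaru extension theorem** (every
universe): granted `exists_diffeomorph_comp_incl_eq` (Laudenbach–Poénaru 1972; for genus `0` this
is Cerf's `Γ₄ = 0`), the closed achiral Lefschetz model `X̂(P; [])` of the empty word over any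
compact connected oriented page bounds a compact 5-dimensional `1`-handlebody, by a smooth
embedding onto the boundary — §1 (the model of `[]` is `B ∪ V` for two compact connected orientable
`1`-handlebodies, Gompf–Stipsicz 1999 §8.2) and §2 (`B ∪ V ≅ D(B) = ∂(B × I)`, Kirby 1989 Ch. I §2).
The discharge `exists_isHandlebodyOfIndexLE_one_of_isAchiralLefschetzModel_nil_holds` is this
theorem applied to `exists_diffeomorph_comp_incl_eq_holds`, once that lands.
[cite: LaudenbachPoenaruBSMF1972, main theorem] [cite: GompfStipsiczGSM1999, §4.4 and §8.2] -/
theorem exists_isHandlebodyOfIndexLE_one_of_isAchiralLefschetzModel_nil_holds_of_LP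
    (hLP : exists_diffeomorph_comp_incl_eq.{u}) :
    exists_isHandlebodyOfIndexLE_one_of_isAchiralLefschetzModel_nil.{u, v} := by
  intro P _ _ _ _ _ _ _ o M _ _ _ _ _ hM
  -- the instances of `B` and `V` enter the context as local instances
  obtain ⟨B, _, _, _, _, _, _, _, V, _, _, _, _, _, _, _, b, bV, ψ, hB, hBo, hV, hVo, hglue⟩ :=
    hM.exists_isBoundaryGluing_oneHandlebody_of_nil
  exact exists_isHandlebodyOfIndexLE_one_of_isBoundaryGluing_oneHandlebody_of_LP hLP B V hB hBo hV
    hVo b bV ψ hglue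

/-- **Fact (3) of the null tower at universe `0` from the Laudenbach–Poénaru extension theorem at
universe `0`** — the instance consumed by the line `hurwitz-deletion-presentation` of the crux
`ConvexBisection.AcyclicBisectionRigidity` (item stmt-SmoothPoincare4-10507, registered stub
`stub_factNullTower`, third conjunct). [cite: LaudenbachPoenaruBSMF1972, main theorem] -/
theorem exists_isHandlebodyOfIndexLE_one_of_isAchiralLefschetzModel_nil_holds0_of_LP
    (hLP : exists_diffeomorph_comp_incl_eq.{0}) :
    exists_isHandlebodyOfIndexLE_one_of_isAchiralLefschetzModel_nil.{0, 0} :=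
  exists_isHandlebodyOfIndexLE_one_of_isAchiralLefschetzModel_nil_holds_of_LP hLP

end Literature.Topology.FourManifolds

end
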